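import Mathlib
import Summits.PneNP.PneNP.Theorems.ConvexRankGatesConvexGateBlindTwoWeightMeasures

/-!
# PneNP / ConvexRankGates — `ConvexGateBlind`: exact two-weight fractional clique decompositions of `K_m`

Helpers (`--supports stmt-PneNP-10680`), COLUMN-SPACE line (prover seat 2, session 19). The PRIMAL form of the linear
ℓ₁-bound `…L1Linear.sum_sum_abs_le_linear`, as an explicit construction: for every symmetric pattern `F` with entries in
`[0,1]` there is a non-negative weighting `ω` of the `k`-subsets of `Fin m` whose pair marginals are EXACTLY

  `∑_{Q ∋ x,y} ω(Q) = κ · (1 + ε · F x y)`   for all `x ≠ y`,  with `κ > 0` and `ε ≥ 1/(16k − 2)`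

(`two_weight_decomposition`; `4 ≤ k`, `2k + 2 ≤ m`). In words: every edge weighting of `K_m` with weights in `{1, 1+ε}` (more
generally in `[1, 1+ε]`), `ε ≤ 1/(16k−2)`, is a non-negative combination of edge sets of `k`-cliques — a two-weight fractional
`K_k`-decomposition theorem with an explicit, exact design: `ω` = POOL MEASURE (`…PoolMeasure`/`…PoolPair`, pair marginals
`α + β·rc F`) + a multiple of the DEGREE MEASURE (`k`-sets weighted by `∑_{z∈Q} deg F z`, pair marginals affine in
`deg F x + deg F y`, which cancels the degree part of `rc F`); odd `k` from `k+1` by splitting each `(k+1)`-set uniformly into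
its `k`-subsets (`split_marginal`). The order `1/k` is sharp (cut pattern, `…L1LowerBound`). [new]
-/

set_option linter.dupNamespace false

namespace Summit.PneNP.PneNP.Theorems

open Finset

noncomputable section

variable {m : ℕ}

/-! ## The mixture -/

/-- Arithmetic of the mixture constant: `0 < κ ≤ (32r − 18)·β`. [new] -/
theorem decomp_endgame {r m c T C3 B1 : ℝ} (hr : 2 ≤ r) (hm : 4 * r ≤ m) (hc : 1 / 3 ≤ c) (hT0 : 0 ≤ T)
    (hT : T ≤ m * (m - 1)) (hB1 : 0 < B1) (hC3 : 0 ≤ C3) (hrel : B1 * (2 * r - 2) = C3 * (m - 2 * r)) :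
    0 < 2 * r * (2 * r - 1) / (m * (m - 1)) + 2 * r * (1 / 4) * c / (m * (m - 1)) * T / ((m - 1) * (m - 2)) +
        2 * r * (1 / 4) * c / (m * (m - 1)) / ((m - 2) * B1) * C3 * T ∧
      2 * r * (2 * r - 1) / (m * (m - 1)) + 2 * r * (1 / 4) * c / (m * (m - 1)) * T / ((m - 1) * (m - 2)) +
        2 * r * (1 / 4) * c / (m * (m - 1)) / ((m - 2) * B1) * C3 * T ≤
        (32 * r - 18) * (2 * r * (1 / 4) * c / (m * (m - 1))) := by
  have hm8 : 8 ≤ m := by linarith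
  have hD : 0 < m * (m - 1) := by nlinarith
  have hd1 : 0 < m - 2 := by linarith
  have hd2 : 0 < m - 1 := by linarith
  have hd3 : 0 < m - 2 * r := by linarith
  set β : ℝ := 2 * r * (1 / 4) * c / (m * (m - 1)) with hβ
  have hβ0 : 0 < β := by rw [hβ]; exact div_pos (by nlinarith) hD
  have hα0 : 0 < 2 * r * (2 * r - 1) / (m * (m - 1)) := div_pos (by nlinarith) hD
  have h2 : 0 ≤ β * T / ((m - 1) * (m - 2)) := div_nonneg (mul_nonneg hβ0.le hT0) (by positivity)
  have h3 : 0 ≤ β / ((m - 2) * B1) * C3 * T := by positivity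
  refine ⟨by linarith, ?_⟩
  -- `α ≤ 12(2r−1)β`
  have hA : 2 * r * (2 * r - 1) / (m * (m - 1)) ≤ 12 * (2 * r - 1) * β := by
    rw [hβ, div_le_iff₀ hD]
    have : 12 * (2 * r - 1) * (2 * r * (1 / 4) * c / (m * (m - 1))) * (m * (m - 1)) = 6 * r * (2 * r - 1) * c := by
      field_simp
      ring
    rw [this]
    have hprod : 0 ≤ 2 * r * (2 * r - 1) * (3 * c - 1) :=
      mul_nonneg (mul_nonneg (by linarith) (by linarith)) (by linarith)
    nlinarith [hprod]
  -- `βT/((m−1)(m−2)) ≤ 2β`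
  have hB : β * T / ((m - 1) * (m - 2)) ≤ 2 * β := by
    rw [div_le_iff₀ (by positivity)]
    have h6 : β * T ≤ β * (m * (m - 1)) := mul_le_mul_of_nonneg_left hT hβ0.le
    have h6' : 0 ≤ β * (m - 1) * (m - 4) := mul_nonneg (mul_nonneg hβ0.le hd2.le) (by linarith)
    nlinarith [h6, h6']
  -- `β C3 T/((m−2)B1) ≤ 4(2r−2)β`
  have hC : β / ((m - 2) * B1) * C3 * T ≤ 4 * (2 * r - 2) * β := by
    have hq : C3 / B1 = (2 * r - 2) / (m - 2 * r) := by
      rw [div_eq_div_iff hB1.ne' hd3.ne']; linarith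
    have h7 : β / ((m - 2) * B1) * C3 * T = β * (C3 / B1) * T / (m - 2) := by
      field_simp
    rw [h7, hq, div_le_iff₀ hd1]
    have hm0 : 0 ≤ m := by linarith
    have h8 : m * (m - 1) ≤ 4 * (m - 2) * (m - 2 * r) := by
      nlinarith [mul_nonneg hm0 (sub_nonneg.2 hm), mul_nonneg hm0 (by linarith : (0 : ℝ) ≤ 4 * r - 7)]
    have h9 : β * ((2 * r - 2) / (m - 2 * r)) * T ≤ β * ((2 * r - 2) / (m - 2 * r)) * (m * (m - 1)) :=
      mul_le_mul_of_nonneg_left hT (mul_nonneg hβ0.le (div_nonneg (by linarith) hd3.le))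
    have h10 : β * ((2 * r - 2) / (m - 2 * r)) * (m * (m - 1)) ≤ β * ((2 * r - 2) / (m - 2 * r)) * (4 * (m - 2) * (m - 2 * r)) :=
      mul_le_mul_of_nonneg_left h8 (mul_nonneg hβ0.le (div_nonneg (by linarith) hd3.le))
    have h11 : β * ((2 * r - 2) / (m - 2 * r)) * (4 * (m - 2) * (m - 2 * r)) = 4 * (2 * r - 2) * β * (m - 2) := by
      field_simp
    exact le_trans h9 (le_trans h10 (le_of_eq h11))
  linarith

/-- **Two-weight fractional clique decomposition, even `k = 2r`** (`2 ≤ r`, `4r ≤ m`): for every symmetric `F` with entries in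
`[0,1]` there is `ω ≥ 0` on the `2r`-subsets with pair marginals EXACTLY `κ·(1 + ε·F x y)`, `κ > 0`, `ε ≥ 1/(32r − 18)`. [new] -/
theorem two_weight_decomposition_even {r : ℕ} (hr : 2 ≤ r) (hm : 4 * r ≤ m) (F : Fin m → Fin m → ℝ)
    (hF : ∀ a b, F a b = F b a) (hF0 : ∀ a b, 0 ≤ F a b) (hF1 : ∀ a b, F a b ≤ 1) :
    ∃ ω : Finset (Fin m) → ℝ, (∀ Q, 0 ≤ ω Q) ∧ (∀ Q, ω Q ≠ 0 → Q.card = 2 * r) ∧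
      ∃ κ ε : ℝ, 0 < κ ∧ 1 / (32 * (r : ℝ) - 18) ≤ ε ∧
        ∀ x y, x ≠ y → ∑ Q, ω Q * (if x ∈ Q ∧ y ∈ Q then (1 : ℝ) else 0) = κ * (1 + ε * F x y) := by
  classical
  -- pool size and weights
  have hr0 : 0 < r := by omega
  set nP : ℕ := m / r with hnP
  have hn4 : 4 ≤ nP := by rw [hnP, Nat.le_div_iff_mul_le hr0]; omega
  have hnr : nP * r ≤ m := by rw [hnP]; exact Nat.div_mul_le_self m r
  have hnm : nP ≤ m := le_trans (Nat.le_mul_of_pos_right _ hr0) hnr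
  have hν : ∀ (P : Finset (Fin m)) (a b : Fin m), P.card = nP → a ∈ P → b ∈ P → 0 ≤ poolNu (1 / 4) nP F P a b :=
    fun P a b hP ha hb => poolNu_nonneg (1 / 4) nP F hF0 hF1 (by norm_num) (by norm_num) hP hn4 ha hb
  set g : Fin m → ℝ := fun z => poolDeg (Finset.univ : Finset (Fin m)) F z with hg
  set T : ℝ := poolTot (Finset.univ : Finset (Fin m)) F with hT
  set c : ℝ := poolCoef m nP with hc
  set β : ℝ := poolBeta (1 / 4) nP r m with hβ
  set C3 : ℝ := ((m - 3).choose (2 * r - 3) : ℝ) with hC3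
  set B1 : ℝ := ((m - 3).choose (2 * r - 2) : ℝ) with hB1
  set lam : ℝ := β / (((m : ℝ) - 2) * B1) with hlam
  -- real facts
  have hrR : (2 : ℝ) ≤ r := by exact_mod_cast hr
  have hmR : 4 * (r : ℝ) ≤ m := by exact_mod_cast hm
  have hnR : (4 : ℝ) ≤ nP := by exact_mod_cast hn4
  have hnmR : (nP : ℝ) ≤ m := by exact_mod_cast hnm
  have hc3 : 1 / 3 ≤ c := by
    have h1 := poolCoef_ge hnR hnmR
    have h2 : (1 : ℝ) / 3 ≤ ((nP : ℝ) - 3) / ((nP : ℝ) - 1) := by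
      rw [div_le_div_iff₀ (by norm_num) (by linarith)]; linarith
    exact le_trans h2 h1
  have hB1pos : 0 < B1 := by rw [hB1]; exact_mod_cast Nat.choose_pos (by omega)
  have hC3nn : 0 ≤ C3 := by rw [hC3]; positivity
  have hrel : B1 * (2 * (r : ℝ) - 2) = C3 * ((m : ℝ) - 2 * r) := by
    have h := Nat.choose_succ_right_eq (m - 3) (2 * r - 3)
    have e1 : 2 * r - 3 + 1 = 2 * r - 2 := by omega
    rw [e1] at h
    have h' : (((m - 3).choose (2 * r - 2) : ℕ) : ℝ) * ((2 * r - 2 : ℕ) : ℝ) =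
        (((m - 3).choose (2 * r - 3) : ℕ) : ℝ) * ((m - 3 - (2 * r - 3) : ℕ) : ℝ) := by exact_mod_cast h
    have c1 : ((2 * r - 2 : ℕ) : ℝ) = 2 * (r : ℝ) - 2 := by rw [Nat.cast_sub (by omega)]; push_cast; ring
    have c2 : ((m - 3 - (2 * r - 3) : ℕ) : ℝ) = (m : ℝ) - 2 * r := by
      rw [Nat.cast_sub (by omega), Nat.cast_sub (by omega), Nat.cast_sub (by omega)]; push_cast; ring
    rw [c1, c2] at h'
    rw [hB1, hC3]; exact h'
  have hpascal : ((m - 2).choose (2 * r - 2) : ℝ) = C3 + B1 := by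
    have h := Nat.choose_succ_succ' (m - 3) (2 * r - 3)
    have e1 : m - 3 + 1 = m - 2 := by omega
    have e2 : 2 * r - 3 + 1 = 2 * r - 2 := by omega
    rw [e1, e2] at h
    rw [hC3, hB1]; exact_mod_cast h
  have hT0 : 0 ≤ T := poolTot_nonneg _ F hF0
  have hTle : T ≤ (m : ℝ) * ((m : ℝ) - 1) := by
    rw [hT]
    unfold poolTot
    have hcard : ((Finset.univ : Finset (Fin m)).card : ℝ) = m := by rw [Finset.card_univ, Fintype.card_fin]
    calc ∑ x, poolDeg Finset.univ F x ≤ ∑ _x : Fin m, ((m : ℝ) - 1) :=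
          Finset.sum_le_sum fun x _ => by
            have := poolDeg_le (Finset.univ : Finset (Fin m)) F hF1 (Finset.mem_univ x)
            rwa [hcard] at this
      _ = (m : ℝ) * ((m : ℝ) - 1) := by
          rw [Finset.sum_const, nsmul_eq_mul, Finset.card_univ, Fintype.card_fin]
  have hm8 : (8 : ℝ) ≤ m := by linarith
  have hβnn : 0 ≤ β := by
    rw [hβ]; unfold poolBeta
    exact div_nonneg (by rw [← hc]; nlinarith) (by nlinarith)
  have hlam0 : 0 ≤ lam := by rw [hlam]; exact div_nonneg hβnn (mul_nonneg (by linarith) hB1pos.le)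
  -- the measure
  refine ⟨fun Q => poolOmega (1 / 4) nP F r Q + lam * degOmega g (2 * r) Q, fun Q => ?_, fun Q hQ => ?_, ?_⟩
  · exact add_nonneg (poolOmega_nonneg _ _ _ hν r Q) (mul_nonneg hlam0 (degOmega_nonneg g (fun z => poolDeg_nonneg _ F hF0 z) _ Q))
  · dsimp only at hQ
    by_contra hc'
    apply hQ
    rw [poolOmega_eq_zero _ _ _ r hc']
    unfold degOmega
    rw [if_neg hc']
    ring
  -- the marginals
  set κ : ℝ := poolAlpha r m + β * T / (((m : ℝ) - 1) * ((m : ℝ) - 2)) + lam * C3 * T with hκ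
  have hend := decomp_endgame (C3 := C3) (B1 := B1) (T := T) hrR hmR hc3 hT0 hTle hB1pos hC3nn hrel
  have hακ : κ = 2 * (r : ℝ) * (2 * (r : ℝ) - 1) / ((m : ℝ) * ((m : ℝ) - 1)) +
      2 * (r : ℝ) * (1 / 4) * c / ((m : ℝ) * ((m : ℝ) - 1)) * T / (((m : ℝ) - 1) * ((m : ℝ) - 2)) +
      2 * (r : ℝ) * (1 / 4) * c / ((m : ℝ) * ((m : ℝ) - 1)) / (((m : ℝ) - 2) * B1) * C3 * T := by
    rw [hκ, hlam, hβ, hc]; unfold poolAlpha poolBeta; ring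
  have hβ' : β = 2 * (r : ℝ) * (1 / 4) * c / ((m : ℝ) * ((m : ℝ) - 1)) := by rw [hβ, hc]; unfold poolBeta; ring
  have hκpos : 0 < κ := by rw [hακ]; exact hend.1
  have hκle : κ ≤ (32 * (r : ℝ) - 18) * β := by rw [hακ, hβ']; exact hend.2
  have hβpos : 0 < β := by
    -- `β > 0` since `c ≥ 1/3`
    rw [hβ']; exact div_pos (by nlinarith) (by nlinarith)
  refine ⟨κ, β / κ, hκpos, ?_, fun x y hxy => ?_⟩
  · rw [div_le_div_iff₀ (by linarith) hκpos]; linarith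
  · rw [Finset.sum_congr rfl (fun Q _ => by rw [add_mul]), Finset.sum_add_distrib]
    have h1 := sum_poolOmega_pair (1 / 4) nP F hF hn4 r hnr hxy
    have h2 := sum_degOmega_pair g (k := 2 * r) (by omega) hxy
    have h2' : ∑ Q, lam * degOmega g (2 * r) Q * (if x ∈ Q ∧ y ∈ Q then (1 : ℝ) else 0) =
        lam * (((m - 2).choose (2 * r - 2) : ℝ) * (g x + g y) + C3 * (∑ z, g z - g x - g y)) := by
      rw [← h2, Finset.mul_sum]
      exact Finset.sum_congr rfl fun Q _ => by ring
    rw [h1, h2', hpascal]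
    have hTsum : ∑ z, g z = T := rfl
    rw [hTsum]
    have hcard : ((Finset.univ : Finset (Fin m)).card : ℝ) = m := by rw [Finset.card_univ, Fintype.card_fin]
    have hrc : poolRc (Finset.univ : Finset (Fin m)) F x y = F x y - (g x + g y) / ((m : ℝ) - 2) + T / (((m : ℝ) - 1) * ((m : ℝ) - 2)) := by
      unfold poolRc; rw [hcard]
    rw [hrc, ← hβ]
    have hm2 : (m : ℝ) - 2 ≠ 0 := by linarith
    have hm1 : (m : ℝ) - 1 ≠ 0 := by linarith
    have hB1ne : B1 ≠ 0 := hB1pos.ne'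
    have hL : poolAlpha r m + β * (F x y - (g x + g y) / ((m : ℝ) - 2) + T / (((m : ℝ) - 1) * ((m : ℝ) - 2))) +
        lam * ((C3 + B1) * (g x + g y) + C3 * (T - g x - g y)) = κ + β * F x y := by
      rw [hκ, hlam]
      field_simp
      ring
    rw [hL]
    have hκne : κ ≠ 0 := hκpos.ne'
    field_simp

/-! ## The theorem -/

/-- **Two-weight fractional clique decompositions of `K_m`.** For `4 ≤ k`, `2k + 2 ≤ m` and every symmetric `F` with entries in
`[0,1]` there is a non-negative weighting `ω` of the `k`-subsets of `Fin m` with pair marginals EXACTLY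
`∑_{Q ∋ x,y} ω(Q) = κ·(1 + ε·F x y)` for all `x ≠ y`, where `κ > 0` and `ε ≥ 1/(16k − 2)`. Equivalently: every edge weighting
of `K_m` with values in `[1, 1 + 1/(16k−2)]` is a non-negative combination of edge sets of `k`-cliques. [new] -/
theorem two_weight_decomposition {k : ℕ} (hk : 4 ≤ k) (hm : 2 * k + 2 ≤ m) (F : Fin m → Fin m → ℝ)
    (hF : ∀ a b, F a b = F b a) (hF0 : ∀ a b, 0 ≤ F a b) (hF1 : ∀ a b, F a b ≤ 1) :
    ∃ ω : Finset (Fin m) → ℝ, (∀ Q, 0 ≤ ω Q) ∧ (∀ Q, ω Q ≠ 0 → Q.card = k) ∧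
      ∃ κ ε : ℝ, 0 < κ ∧ 1 / (16 * (k : ℝ) - 2) ≤ ε ∧
        ∀ x y, x ≠ y → ∑ Q, ω Q * (if x ∈ Q ∧ y ∈ Q then (1 : ℝ) else 0) = κ * (1 + ε * F x y) := by
  rcases Nat.even_or_odd k with ⟨r, hr⟩ | ⟨r, hr⟩
  · -- even `k = 2r`
    have hr2 : 2 ≤ r := by omega
    have hk2 : k = 2 * r := by omega
    subst hk2
    obtain ⟨ω, hω0, hωs, κ, ε, hκ, hε, hmarg⟩ := two_weight_decomposition_even hr2 (by omega) F hF hF0 hF1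
    refine ⟨ω, hω0, hωs, κ, ε, hκ, le_trans ?_ hε, hmarg⟩
    have hrR : (2 : ℝ) ≤ r := by exact_mod_cast hr2
    push_cast
    exact one_div_le_one_div_of_le (by linarith) (by linarith)
  · -- odd `k = 2r + 1`: decompose into `(k+1)`-sets and split
    have hr2 : 2 ≤ r := by omega
    obtain ⟨ω, hω0, hωs, κ, ε, hκ, hε, hmarg⟩ :=
      two_weight_decomposition_even (r := r + 1) (by omega) (by omega) F hF hF0 hF1
    have hsupp : ∀ Q, ω Q ≠ 0 → Q.card = k + 1 := fun Q hQ => by rw [hωs Q hQ]; omega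
    refine ⟨splitOmega ω k, fun Q => splitOmega_nonneg ω hω0 k Q, fun Q hQ => ?_, ((k : ℝ) - 1) * κ, ε, ?_, ?_, fun x y hxy => ?_⟩
    · by_contra hc
      exact hQ (by unfold splitOmega; rw [if_neg hc])
    · have hkR : (5 : ℝ) ≤ k := by exact_mod_cast (show 5 ≤ k by omega)
      exact mul_pos (by linarith) hκ
    · refine le_trans (le_of_eq ?_) hε
      rw [hr]; push_cast; ring
    · rw [sum_splitOmega_pair ω hsupp hxy, hmarg x y hxy]; ring

/-- **Two-weight fractional clique decompositions of `K_m`** (registered form of `two_weight_decomposition`). [new] -/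
theorem two_weight_clique_decomposition : ∀ {m k : ℕ}, 4 ≤ k → 2 * k + 2 ≤ m → ∀ (F : Fin m → Fin m → ℝ), (∀ a b, F a b = F b a) → (∀ a b, 0 ≤ F a b) → (∀ a b, F a b ≤ 1) → ∃ ω : Finset (Fin m) → ℝ, (∀ Q, 0 ≤ ω Q) ∧ (∀ Q, ω Q ≠ 0 → Q.card = k) ∧ ∃ κ ε : ℝ, 0 < κ ∧ 1 / (16 * (k : ℝ) - 2) ≤ ε ∧ ∀ x y, x ≠ y → ∑ Q, ω Q * (if x ∈ Q ∧ y ∈ Q then (1 : ℝ) else 0) = κ * (1 + ε * F x y) :=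
  fun hk hm F hF hF0 hF1 => two_weight_decomposition hk hm F hF hF0 hF1

end

end Summit.PneNP.PneNP.Theorems
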